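import Summits.BirchSwinnertonDyer.BirchSwinnertonDyer.Theorems.SignedLowerHalvesSmallImageLowerHalfBothSignsRttOneSidedCruxTieredUnit
import Summits.BirchSwinnertonDyer.BirchSwinnertonDyer.Theorems.SignedLowerHalvesSmallImageLowerHalfBothSignsRttEngineOfPartnerSelmerBoundNs
import HarnessLib

/-!
# Route `SignedLowerHalves`, crux L `SmallImageLowerHalfBothSigns` (item stmt-BirchSwinnertonDyer-23599), line `rtt_w3` —
# the transport from an ∃-BUNDLED partner: crux L BY NAME from print ∧ floor ∧ Kan₂ ∧ «on tier T3 there EXISTS a congruent CM partner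
# with cohomological period SATISFYING the partner Selmer bound» (a v6 composition target offered by the LEAD)

LEAD `cruxlead-stmt-BirchSwinnertonDyer-23599` g3 (cell `bsd-ssimc`); helper `--supports stmt-BirchSwinnertonDyer-23599`; THEOREMS ONLY — no
definition, no named fact, no `sorry`; a sorry-free SKELETON-SHAPED composition, not a proof of crux L; BSD is not proved by any of this.

WHAT CHANGES vs `…RttOneSidedCruxTieredUnit` (p752208, width seat -w3 g13) and the registered v5 (PSB_T3 = «for ALL level-matched CM
partners `g` … the partner Selmer bound»). The composition only ever USES the engine at ONE partner — K0₂'s. So the research stub may be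
asked in the strictly WEAKER ∃-form `hEX3`: on a tier-T3 pair (neither CM-curve nor unit-curve partner), for each sign `ε`, THERE IS a
`Γ₀(M)` newform `g` (`p ∤ M`, CM form, `a_p(g) = 0`, cohomological plus period along `ι`, `a_ℓ(g) ≡ a_ℓ(W)` off `p·M·N_W`) satisfying the
partner Selmer bound (PSB, -w3 g12 currency) — no level clause asked (it is DERIVED for every such partner by `stub_levelMatch_ns`, p742955:
Deligne/Carayol/Saito by name), K0₂ (p741818) no longer inside the composition (it is how a prover of `hEX3` will produce `g`; the character
road of record — census `Lines/rtt_w3-CENSUS-PSB-g3.md` — proves PSB only for THAT `g = θ_φ`, through its Grössencharacter `φ`, which is why the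
∀-form was the wrong registered text). §1 `lamTransport_le_tiered3_of_existsPartnerPSB` = p752208's §1 with the T3 branch fed by `hEX3` and the
pointwise engine `SmallImageRttLayerLawK.partnerLayerLambdaLower_of_partnerSelmerBound` (p749152); §2 ★
`smallImageLowerHalfBothSigns_of_oneSignFloor_of_existsPartnerPSB` = crux L BY NAME from `hJ h12 h41 h5 h3 hD hC hS hmod hKim hPR hV` (the v5 cite
stub's twelve facts), `hfloor5` (= `stub_muOneSign_ns_ge5`), `hKan` (= Kan₂, landed p747435) and `hEX3`.

References: [Kobayashi2003] Conjecture (p. 2), (3.6), Thm. 1.2, 4.1, 7.4; [BDKim2009] Cor. 2.13; [PollackRubin2004] Theorem (p. 448);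
[Vatsal1999] (1.6), (1.13); [PollackWeston2011MT] §3.1, Thm. 4.1; [GreenbergVatsal2000] Prop. (2.4), §3 Rem. 3.4; [Pollack2003] Conj. 6.3, Prop. 6.18.
-/

set_option autoImplicit false
-- D-0017: single-problem summit, the namespace repeats the problem name by design.
set_option linter.dupNamespace false
noncomputable section

open scoped Classical MatrixGroups ModularForm BigOperators

open CongruenceSubgroup WeierstrassCurve Field Polynomial NumberField IsDedekindDomain
  Literature.NumberTheory.EllipticCurves Literature.NumberTheory.EllipticCurves.ModularForms
  Literature.NumberTheory.EllipticCurves.Rank1Residual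
  Literature.NumberTheory.EllipticCurves.Kobayashi2003
  Literature.NumberTheory.EllipticCurves.GreenbergVatsal2000 ZpExtension
  Literature.NumberTheory.IwasawaTheory Rat.HeightOneSpectrum
  Summit.BirchSwinnertonDyer.Rank1Residual.Supersingular
  Summit.BirchSwinnertonDyer.Rank1Residual.X1.MuLambda
  Summit.BirchSwinnertonDyer.Rank1Residual.X2.EulerFactorInvariants
  Summit.BirchSwinnertonDyer.BirchSwinnertonDyer.Theorems.SmallImageLambdaLowerThreeNsThetaTransport

namespace Summit.BirchSwinnertonDyer.BirchSwinnertonDyer.Theorems.SmallImageRttOneSided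

/-! ## §1 The transport tiered three ways, tier T3 fed by an ∃-bundled partner with its Selmer bound -/

section Tiered

/-- **The one-sided λ-transport on the small-image class, TIERED THREE WAYS, tier T3 from an ∃-bundled partner.** As
`lamTransport_le_tiered3` (p752208) — T1 by the landed CM-curve engine (p745857), T1u by the landed unit-curve engine (p750944) — but on
T3 the partner `g` and its Selmer bound come TOGETHER from `hEX3` (∃-form of the v5 stub PSB_T3, WITHOUT the level clause, which is derived
here by `stub_levelMatch_ns`), and ENG at `g` is the pointwise engine `partnerLayerLambdaLower_of_partnerSelmerBound`. CONDITIONAL; closes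
nothing. [cite: Kobayashi2003, (3.6)] [cite: BDKim2009, Cor. 2.13] [cite: PollackRubin2004, Theorem (p. 448)]
[cite: PollackWeston2011MT, §3.1, Thm. 4.1 (1)] [cite: Pollack2003, Prop. 6.18] -/
theorem lamTransport_le_tiered3_of_existsPartnerPSB
    (h12 : thm12_signedSelmerDual_finite_torsion)
    (hKim : BDKim2009.cor213_signedLambda_add_sum_delta_eq_of_torsionIso)
    (hPR : PollackRubin2004.mainTheorem_signedCharIdeal_eq_of_cm) (hmod : exists_isNewformOf)
    (hD : Hida2000_thm326_exists_galoisRep) (hC : Carayol1986_artinConductorExponent)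
    (hS : ∀ (V : WeierstrassCurve ℚ) (ℓ : ℕ) [Fact ℓ.Prime],
      V.swanConductorAt_rationalTate_eq_wildConductorExponent_of_ringChar_eq_two ℓ)
    (h5 : realPeriodRat_eq_unit_mul_plusPeriod) (h3 : realPeriodRat_eq_unit_mul_plusPeriod_three)
    (hV : vatsal1999_plusSymbol_congruence)
    (hKan : ∀ (W : WeierstrassCurve ℚ) [W.IsElliptic] [W.IsGloballyMinimal] (p : ℕ) [Fact p.Prime],
      p ≠ 2 → ClassX7 W p → ¬ W.HasCM → W.frobeniusTrace p = 0 → ¬ Surj W p →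
      ∀ (ε : ℤˣ), ∀ (M : ℕ) [NeZero M] (g : CuspForm (Gamma0 M) 2) (ι : coeffField g →+* PadicAlgCl p) (Ω : ℂ),
        ¬ p ∣ M → (∀ ℓ : ℕ, ℓ.Prime → ℓ ≠ p → max 2 (padicValNat ℓ M) = max 2 (padicValNat ℓ (W.conductorNorm ℤ))) →
        IsNewform0 g → Literature.NumberTheory.Automorphic.IsCMForm (liftToGamma1 M 2 g) →
        cuspCoeff g p = 0 → IsPlusPeriod g Ω →
        (∀ ℓ : ℕ, ℓ.Prime → ¬ ℓ ∣ p * M * W.conductorNorm ℤ →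
          ‖embCoeff g ι ℓ - (W.frobeniusTrace ℓ : PadicAlgCl p)‖ < 1) →
        ∀ [NeZero (W.conductorNorm ℤ)] (f : CuspForm (Gamma0 (W.conductorNorm ℤ)) 2), IsNewformOf W f →
        ∀ (Lplus Lminus : IwasawaAlgebra p), IsPollackPair f p Lplus Lminus →
          HasUnitContent (kobayashiL ε Lplus Lminus) →
        ∀ (S₀ : Finset (HeightOneSpectrum (𝓞 ℚ))), (∀ v ∈ S₀, ((p : ℕ) : 𝓞 ℚ) ∉ v.asIdeal) →
          (∀ v : HeightOneSpectrum (𝓞 ℚ), ¬ W.HasGoodReductionAt v → v ∈ S₀) →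
          (∀ v : HeightOneSpectrum (𝓞 ℚ), natGenerator v ∣ M → v ∈ S₀) →
        ∃ n₀ : ℕ, ∀ n ≥ n₀, (Even n ↔ ε = 1) →
          layerLambda (((mazurTateElement f p n).map (algebraMap ℚ (PadicAlgCl p)) *
              ∏ v ∈ S₀, ((W.localPolynomialAt v).map (Int.castRingHom (PadicAlgCl p))).comp
                (C ((natGenerator v : PadicAlgCl p)⁻¹) *
                  (X + 1) ^ (PadicInt.toZModPow n (-(frobeniusExponent p (natGenerator v : ℤ_[p])))).val)) %ₘ
              ((X + 1) ^ p ^ n - 1)) =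
          layerLambda (((mazurTateElementK g Ω p n).map ι *
              ∏ v ∈ S₀, (1 - C (embCoeff g ι (natGenerator v)) * X +
                  (if natGenerator v ∣ M then 0 else C (natGenerator v : PadicAlgCl p)) * X ^ 2).comp
                (C ((natGenerator v : PadicAlgCl p)⁻¹) *
                  (X + 1) ^ (PadicInt.toZModPow n (-(frobeniusExponent p (natGenerator v : ℤ_[p])))).val)) %ₘ
              ((X + 1) ^ p ^ n - 1)))
    (hEX3 : ∀ (W : WeierstrassCurve ℚ) [W.IsElliptic] [W.IsGloballyMinimal] (p : ℕ) [Fact p.Prime],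
      p ≠ 2 → ClassX7 W p → ¬ W.HasCM → W.frobeniusTrace p = 0 → ¬ Surj W p →
      ¬ (∃ (A : WeierstrassCurve ℚ) (_ : A.IsElliptic) (_ : A.IsGloballyMinimal),
        A.HasCM ∧ GoodSS A p ∧ A.frobeniusTrace p = 0 ∧
          ∃ e : geomTorsion W (p : ℤ) ≃+ geomTorsion A (p : ℤ),
            ∀ (σ : absoluteGaloisGroup ℚ) (P : geomTorsion W (p : ℤ)), e (σ • P) = σ • e P) →
      ¬ (∃ (A : WeierstrassCurve ℚ) (_ : A.IsElliptic) (_ : A.IsGloballyMinimal) (t : ℚ),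
        A.HasGoodReductionAtPrime p ∧ A.frobeniusTrace p = 0 ∧
          (∃ e : geomTorsion W (p : ℤ) ≃+ geomTorsion A (p : ℤ),
            ∀ (σ : absoluteGaloisGroup ℚ) (P : geomTorsion W (p : ℤ)), e (σ • P) = σ • e P) ∧
          A.entireLFunction 1 / (A.realPeriodRat : ℂ) = ((t : ℚ) : ℂ) ∧ t ≠ 0 ∧ padicValRat p t = 0) →
      ∀ (ε : ℤˣ), ∃ (M : ℕ) (_ : NeZero M) (g : CuspForm (Gamma0 M) 2) (ι : coeffField g →+* PadicAlgCl p) (Ω : ℂ),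
        ¬ p ∣ M ∧ IsNewform0 g ∧ Literature.NumberTheory.Automorphic.IsCMForm (liftToGamma1 M 2 g) ∧
          cuspCoeff g p = 0 ∧ IsCohomologicalPlusPeriod g ι Ω ∧
          (∀ ℓ : ℕ, ℓ.Prime → ¬ ℓ ∣ p * M * W.conductorNorm ℤ →
            ‖embCoeff g ι ℓ - (W.frobeniusTrace ℓ : PadicAlgCl p)‖ < 1) ∧
          ∀ (κ : ZpExtension ℚ p) (γ : absoluteGaloisGroup ℚ),
            κ.IsCyclotomic → κ.IsTopGenerator γ → IsCyclotomicVariable p γ →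
          ∀ (S₀ : Finset (HeightOneSpectrum (𝓞 ℚ))), (∀ v ∈ S₀, ((p : ℕ) : 𝓞 ℚ) ∉ v.asIdeal) →
            (∀ v : HeightOneSpectrum (𝓞 ℚ), ¬ W.HasGoodReductionAt v → v ∈ S₀) →
            (∀ v : HeightOneSpectrum (𝓞 ℚ), natGenerator v ∣ M → v ∈ S₀) →
          ∀ (D : SignedSelmerDualData W κ γ ε) [Module.Finite (IwasawaAlgebra p) D.X],
            Module.IsTorsion (IwasawaAlgebra p) D.X → D.mu = 0 →
          ∀ L : IwasawaAlgebraO (Set.range ι), L ≠ 0 →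
            (∀ n : ℕ, (Even n ↔ ε = 1) → IsCongrModOmegaO (Set.range ι) n ((mazurTateElementK g Ω p n).map ι)
              (((((-1) ^ (n / 2 + 1) * (if ε = 1 then cyclotomicOmegaMinus p n else cyclotomicOmegaPlus p n)).map
                  (Int.castRingHom (PadicAlgCl p)) : (PadicAlgCl p)[X]) : PowerSeries (PadicAlgCl p)) *
                iwasawaOToPowerSeries (Set.range ι) L)) →
            ∃ d : ℕ, (∀ k : ℕ, ‖PowerSeries.coeff k (iwasawaOToPowerSeries (Set.range ι) L)‖ ≤
                ‖PowerSeries.coeff d (iwasawaOToPowerSeries (Set.range ι) L)‖) ∧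
              (∀ k : ℕ, k < d → ‖PowerSeries.coeff k (iwasawaOToPowerSeries (Set.range ι) L)‖ <
                ‖PowerSeries.coeff d (iwasawaOToPowerSeries (Set.range ι) L)‖) ∧
              d + ∑ v ∈ S₀, p ^ (frobeniusExponent p (natGenerator v : ℤ_[p])).valuation *
                layerLambda ((1 - C (embCoeff g ι (natGenerator v)) * X +
                  (if natGenerator v ∣ M then 0 else C (natGenerator v : PadicAlgCl p)) * X ^ 2).comp
                    (C ((natGenerator v : PadicAlgCl p)⁻¹) * (X + 1))) ≤
                lambdaInvariant p D.X + ∑ v ∈ S₀, delta W p v)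
    (W : WeierstrassCurve ℚ) [W.IsElliptic] [W.IsGloballyMinimal] (p : ℕ) [Fact p.Prime]
    (hp : p ≠ 2) (hX : ClassX7 W p) (hcm : ¬ W.HasCM) (hap : W.frobeniusTrace p = 0) (hs : ¬ Surj W p) (ε : ℤˣ) :
    ∀ (κ : ZpExtension ℚ p) (γ : absoluteGaloisGroup ℚ),
      κ.IsCyclotomic → κ.IsTopGenerator γ → IsCyclotomicVariable p γ →
      ∀ [NeZero (W.conductorNorm ℤ)] (f : CuspForm (Gamma0 (W.conductorNorm ℤ)) 2),
        IsNewformOf W f → ∀ (ϖ : ℚ), (ϖ : ℝ) * W.realPeriodRat = plusPeriod f →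
      ∀ (Lplus Lminus : IwasawaAlgebra p), IsPollackPair f p Lplus Lminus →
        HasUnitContent (kobayashiL ε Lplus Lminus) →
      ∀ (D : SignedSelmerDualData W κ γ ε) [Module.Finite (IwasawaAlgebra p) D.X],
        Module.IsTorsion (IwasawaAlgebra p) D.X → D.mu = 0 →
      ∀ (G : IwasawaAlgebra p) (m : ℕ),
        iwasawaToPowerSeries p G =
          PowerSeries.C ((p : ℚ_[p]) ^ m * (ϖ : ℚ_[p])) * iwasawaToPowerSeries p (kobayashiL ε Lplus Lminus) →
        lam G ≤ lambdaInvariant p D.X := by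
  have hgood : W.HasGoodReductionAtPrime p := hX.1.1
  by_cases hT1 : (∃ (A : WeierstrassCurve ℚ) (_ : A.IsElliptic) (_ : A.IsGloballyMinimal),
        A.HasCM ∧ GoodSS A p ∧ A.frobeniusTrace p = 0 ∧
          ∃ e : geomTorsion W (p : ℤ) ≃+ geomTorsion A (p : ℤ),
            ∀ (σ : absoluteGaloisGroup ℚ) (P : geomTorsion W (p : ℤ)), e (σ • P) = σ • e P)
  · -- T1: the partner is `f_A`, ENG is the landed CM-curve engine
    obtain ⟨A, iA₁, iA₂, hcmA, hssA, hapA, he⟩ := hT1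
    obtain ⟨iN, g, ι, Ω, hg, hpN, hlev, hnew, hcmg, hapg, hΩ, hcong, ⟨ϖA, hϖA⟩, hPol⟩ :=
      cmCurvePartner_supply hD hC hS hmod h5 h3 W A p hp hgood hcmA hssA hapA he
    intro κ γ hκ hγ hγ' _ f hf ϖ hϖ Lplus Lminus hPP hfl D _ hXt hμ G m hG
    exact lamTransport_le_of_partner W p hp hgood ε g ι Ω hpN
      (hKan W p hp hX hcm hap hs ε (A.conductorNorm ℤ) g ι Ω hpN hlev hnew hcmg hapg hΩ.isPlusPeriod hcong)
      (fun κ γ hκ hγ hγ' S₀ hS₀p hS₀W hS₀A D _ hXt hμ ↦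
        partnerLayerLambdaLower_of_cmCurvePartner h12 hKim hPR W A p hp hgood hap hcmA hssA hapA he g hg ι Ω
          hΩ.isPlusPeriod ϖA hϖA hPol ε κ γ hκ hγ hγ' S₀ hS₀p hS₀W hS₀A D hXt hμ)
      κ γ hκ hγ hγ' f hf ϖ hϖ Lplus Lminus hPP hfl D hXt hμ G m hG
  by_cases hTu : (∃ (A : WeierstrassCurve ℚ) (_ : A.IsElliptic) (_ : A.IsGloballyMinimal) (t : ℚ),
        A.HasGoodReductionAtPrime p ∧ A.frobeniusTrace p = 0 ∧
          (∃ e : geomTorsion W (p : ℤ) ≃+ geomTorsion A (p : ℤ),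
            ∀ (σ : absoluteGaloisGroup ℚ) (P : geomTorsion W (p : ℤ)), e (σ • P) = σ • e P) ∧
          A.entireLFunction 1 / (A.realPeriodRat : ℂ) = ((t : ℚ) : ℂ) ∧ t ≠ 0 ∧ padicValRat p t = 0)
  · -- T1u: the partner is `f_A` for a unit curve `A`, ENG is the landed unit-curve engine, Kan₂ in binder-free form
    obtain ⟨A, iA₁, iA₂, t, hgoodA, hapA, he, ht, ht0, hvt⟩ := hTu
    exact lamTransport_le_of_unitCurvePartner W A p h12 h5 h3 hD hC hS hmod hKim hV hp hX hap hgoodA hapA he ht ht0 hvt ε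
  · -- T3: the partner AND its Selmer bound come from the ∃-stub; level clause by `stub_levelMatch_ns` (p742955);
    -- ENG at the partner by the pointwise engine `partnerLayerLambdaLower_of_partnerSelmerBound` (p749152)
    obtain ⟨M, hM, g, ι, Ω, hpM, hnew, hcmg, hapg, hΩ, hcong, hPSB⟩ := hEX3 W p hp hX hcm hap hs hT1 hTu ε
    haveI := hM
    have hlev : ∀ ℓ : ℕ, ℓ.Prime → ℓ ≠ p → max 2 (padicValNat ℓ M) = max 2 (padicValNat ℓ (W.conductorNorm ℤ)) :=
      Summit.BirchSwinnertonDyer.BirchSwinnertonDyer.Theorems.SmallImageLambdaLowerThreeNsThetaPartner.stub_levelMatch_ns hD hC hS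
        W p hp hX hcm hap hs M g ι hpM hnew hcmg hcong
    intro κ γ hκ hγ hγ' _ f hf ϖ hϖ Lplus Lminus hPP hfl D _ hXt hμ G m hG
    refine lamTransport_le_of_partner W p hp hgood ε g ι Ω hpM
      (hKan W p hp hX hcm hap hs ε M g ι Ω hpM hlev hnew hcmg hapg hΩ.isPlusPeriod hcong) ?_
      κ γ hκ hγ hγ' f hf ϖ hϖ Lplus Lminus hPP hfl D hXt hμ G m hG
    intro κ' γ' hκ' hγ₁ hγ₂ S₀ hS₀p hS₀W hS₀M D' _ hXt' hμ'
    obtain ⟨n₀, hn₀⟩ :=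
      Summit.BirchSwinnertonDyer.BirchSwinnertonDyer.Theorems.SmallImageRttLayerLawK.partnerLayerLambdaLower_of_partnerSelmerBound
        g ι Ω hnew hΩ hpM hapg ε S₀ hS₀p (lambdaInvariant p D'.X + ∑ v ∈ S₀, delta W p v)
        (hPSB κ' γ' hκ' hγ₁ hγ₂ S₀ hS₀p hS₀W hS₀M D' hXt' hμ')
    refine ⟨n₀, fun n hn hpar ↦ ?_⟩
    have h' : ((layerLambda (((mazurTateElementK g Ω p n).map ι *
                ∏ v ∈ S₀, (1 - C (embCoeff g ι (natGenerator v)) * X +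
                    (if natGenerator v ∣ M then 0 else C (natGenerator v : PadicAlgCl p)) * X ^ 2).comp
                  (C ((natGenerator v : PadicAlgCl p)⁻¹) *
                    (X + 1) ^ (PadicInt.toZModPow n (-(frobeniusExponent p (natGenerator v : ℤ_[p])))).val)) %ₘ
                ((X + 1) ^ p ^ n - 1)) : ℕ) : ℤ) ≤
        (((if ε = 1 then cyclotomicOmegaMinus p n else cyclotomicOmegaPlus p n).natDegree +
          (lambdaInvariant p D'.X + ∑ v ∈ S₀, delta W p v) : ℕ) : ℤ) := by
      exact_mod_cast hn₀ n hn hpar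
    simp only [Nat.cast_add] at h'
    linarith

end Tiered

/-! ## §2 ★ CLASS-WIDE: crux L BY NAME from print ∧ (one-sign floor at `p ≥ 5`) ∧ Kan₂ ∧ ∃-partner-PSB on T3 (a v6 composition target) -/

section ClassWide

/-- ★ **Crux L `SmallImageLowerHalfBothSigns` BY NAME ⟸ print ∧ (one-sign floor at `p ≥ 5` = `stub_muOneSign_ns_ge5` VERBATIM) ∧
Kan₂ ∧ ∃-partner-PSB on tier T3** — `smallImageLowerHalfBothSigns_of_oneSignFloor_of_rtt_ge_tiered3` (p752208) with the engine hypothesis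
replaced by the strictly weaker `hEX3`: on a pair with neither a CM-curve nor a unit curve partner, for each sign there EXISTS a congruent
`Γ₀(M)` CM partner (`p ∤ M`, `a_p(g) = 0`, cohomological plus period) satisfying the partner Selmer bound. Displayed print: `hJ h12 h41 h5 h3`
(Kobayashi, period units), `hD hC hS` (Deligne/Hida, Carayol, Saito@2 — used for the level clause of the ∃-partner), `hmod`, `hKim`, `hPR`,
`hV`; `hfloor5`, `hKan` = the v5 stubs / landed Kan₂. `p = 3`: floor = THEOREM B; `5 ≤ p`: sign idleness on X7. A sorry-free line-shaped
decomposition; CONDITIONAL; closes nothing; crux L / BSD NOT proved. [cite: Kobayashi2003, Conjecture (p. 2), Thm. 7.4 (p. 13)]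
[cite: Pollack2003, Conj. 6.3] [cite: BDKim2009, Cor. 2.13] [cite: PollackRubin2004, Theorem (p. 448)] [cite: PollackWeston2011MT, §3.1, Thm. 4.1 (1)] -/
theorem smallImageLowerHalfBothSigns_of_oneSignFloor_of_existsPartnerPSB
    (hJ : thm62_63_73_signedColemanKato_zetaJoint) (h12 : thm12_signedSelmerDual_finite_torsion)
    (h41 : thm41_signedCharIdeal_divisibility)
    (h5 : realPeriodRat_eq_unit_mul_plusPeriod) (h3 : realPeriodRat_eq_unit_mul_plusPeriod_three)
    (hD : Hida2000_thm326_exists_galoisRep) (hC : Carayol1986_artinConductorExponent)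
    (hS : ∀ (V : WeierstrassCurve ℚ) (ℓ : ℕ) [Fact ℓ.Prime],
      V.swanConductorAt_rationalTate_eq_wildConductorExponent_of_ringChar_eq_two ℓ)
    (hmod : exists_isNewformOf)
    (hKim : BDKim2009.cor213_signedLambda_add_sum_delta_eq_of_torsionIso)
    (hPR : PollackRubin2004.mainTheorem_signedCharIdeal_eq_of_cm) (hV : vatsal1999_plusSymbol_congruence)
    (hfloor5 : ∀ (W : WeierstrassCurve ℚ) [W.IsElliptic] [W.IsGloballyMinimal] (p : ℕ) [Fact p.Prime],
      5 ≤ p → ClassX7 W p → ¬ W.HasCM → W.frobeniusTrace p = 0 → ¬ Surj W p →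
      ∀ [NeZero (W.conductorNorm ℤ)] (f : CuspForm (Gamma0 (W.conductorNorm ℤ)) 2),
        IsNewformOf W f → ∃ (ε₀ : ℤˣ) (L₀ : IwasawaAlgebra p), IsSignedPAdicLFunction f p ε₀ L₀ ∧ HasUnitContent L₀)
    (hKan : ∀ (W : WeierstrassCurve ℚ) [W.IsElliptic] [W.IsGloballyMinimal] (p : ℕ) [Fact p.Prime],
      p ≠ 2 → ClassX7 W p → ¬ W.HasCM → W.frobeniusTrace p = 0 → ¬ Surj W p →
      ∀ (ε : ℤˣ), ∀ (M : ℕ) [NeZero M] (g : CuspForm (Gamma0 M) 2) (ι : coeffField g →+* PadicAlgCl p) (Ω : ℂ),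
        ¬ p ∣ M → (∀ ℓ : ℕ, ℓ.Prime → ℓ ≠ p → max 2 (padicValNat ℓ M) = max 2 (padicValNat ℓ (W.conductorNorm ℤ))) →
        IsNewform0 g → Literature.NumberTheory.Automorphic.IsCMForm (liftToGamma1 M 2 g) →
        cuspCoeff g p = 0 → IsPlusPeriod g Ω →
        (∀ ℓ : ℕ, ℓ.Prime → ¬ ℓ ∣ p * M * W.conductorNorm ℤ →
          ‖embCoeff g ι ℓ - (W.frobeniusTrace ℓ : PadicAlgCl p)‖ < 1) →
        ∀ [NeZero (W.conductorNorm ℤ)] (f : CuspForm (Gamma0 (W.conductorNorm ℤ)) 2), IsNewformOf W f →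
        ∀ (Lplus Lminus : IwasawaAlgebra p), IsPollackPair f p Lplus Lminus →
          HasUnitContent (kobayashiL ε Lplus Lminus) →
        ∀ (S₀ : Finset (HeightOneSpectrum (𝓞 ℚ))), (∀ v ∈ S₀, ((p : ℕ) : 𝓞 ℚ) ∉ v.asIdeal) →
          (∀ v : HeightOneSpectrum (𝓞 ℚ), ¬ W.HasGoodReductionAt v → v ∈ S₀) →
          (∀ v : HeightOneSpectrum (𝓞 ℚ), natGenerator v ∣ M → v ∈ S₀) →
        ∃ n₀ : ℕ, ∀ n ≥ n₀, (Even n ↔ ε = 1) →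
          layerLambda (((mazurTateElement f p n).map (algebraMap ℚ (PadicAlgCl p)) *
              ∏ v ∈ S₀, ((W.localPolynomialAt v).map (Int.castRingHom (PadicAlgCl p))).comp
                (C ((natGenerator v : PadicAlgCl p)⁻¹) *
                  (X + 1) ^ (PadicInt.toZModPow n (-(frobeniusExponent p (natGenerator v : ℤ_[p])))).val)) %ₘ
              ((X + 1) ^ p ^ n - 1)) =
          layerLambda (((mazurTateElementK g Ω p n).map ι *
              ∏ v ∈ S₀, (1 - C (embCoeff g ι (natGenerator v)) * X +
                  (if natGenerator v ∣ M then 0 else C (natGenerator v : PadicAlgCl p)) * X ^ 2).comp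
                (C ((natGenerator v : PadicAlgCl p)⁻¹) *
                  (X + 1) ^ (PadicInt.toZModPow n (-(frobeniusExponent p (natGenerator v : ℤ_[p])))).val)) %ₘ
              ((X + 1) ^ p ^ n - 1)))
    (hEX3 : ∀ (W : WeierstrassCurve ℚ) [W.IsElliptic] [W.IsGloballyMinimal] (p : ℕ) [Fact p.Prime],
      p ≠ 2 → ClassX7 W p → ¬ W.HasCM → W.frobeniusTrace p = 0 → ¬ Surj W p →
      ¬ (∃ (A : WeierstrassCurve ℚ) (_ : A.IsElliptic) (_ : A.IsGloballyMinimal),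
        A.HasCM ∧ GoodSS A p ∧ A.frobeniusTrace p = 0 ∧
          ∃ e : geomTorsion W (p : ℤ) ≃+ geomTorsion A (p : ℤ),
            ∀ (σ : absoluteGaloisGroup ℚ) (P : geomTorsion W (p : ℤ)), e (σ • P) = σ • e P) →
      ¬ (∃ (A : WeierstrassCurve ℚ) (_ : A.IsElliptic) (_ : A.IsGloballyMinimal) (t : ℚ),
        A.HasGoodReductionAtPrime p ∧ A.frobeniusTrace p = 0 ∧
          (∃ e : geomTorsion W (p : ℤ) ≃+ geomTorsion A (p : ℤ),
            ∀ (σ : absoluteGaloisGroup ℚ) (P : geomTorsion W (p : ℤ)), e (σ • P) = σ • e P) ∧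
          A.entireLFunction 1 / (A.realPeriodRat : ℂ) = ((t : ℚ) : ℂ) ∧ t ≠ 0 ∧ padicValRat p t = 0) →
      ∀ (ε : ℤˣ), ∃ (M : ℕ) (_ : NeZero M) (g : CuspForm (Gamma0 M) 2) (ι : coeffField g →+* PadicAlgCl p) (Ω : ℂ),
        ¬ p ∣ M ∧ IsNewform0 g ∧ Literature.NumberTheory.Automorphic.IsCMForm (liftToGamma1 M 2 g) ∧
          cuspCoeff g p = 0 ∧ IsCohomologicalPlusPeriod g ι Ω ∧
          (∀ ℓ : ℕ, ℓ.Prime → ¬ ℓ ∣ p * M * W.conductorNorm ℤ →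
            ‖embCoeff g ι ℓ - (W.frobeniusTrace ℓ : PadicAlgCl p)‖ < 1) ∧
          ∀ (κ : ZpExtension ℚ p) (γ : absoluteGaloisGroup ℚ),
            κ.IsCyclotomic → κ.IsTopGenerator γ → IsCyclotomicVariable p γ →
          ∀ (S₀ : Finset (HeightOneSpectrum (𝓞 ℚ))), (∀ v ∈ S₀, ((p : ℕ) : 𝓞 ℚ) ∉ v.asIdeal) →
            (∀ v : HeightOneSpectrum (𝓞 ℚ), ¬ W.HasGoodReductionAt v → v ∈ S₀) →
            (∀ v : HeightOneSpectrum (𝓞 ℚ), natGenerator v ∣ M → v ∈ S₀) →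
          ∀ (D : SignedSelmerDualData W κ γ ε) [Module.Finite (IwasawaAlgebra p) D.X],
            Module.IsTorsion (IwasawaAlgebra p) D.X → D.mu = 0 →
          ∀ L : IwasawaAlgebraO (Set.range ι), L ≠ 0 →
            (∀ n : ℕ, (Even n ↔ ε = 1) → IsCongrModOmegaO (Set.range ι) n ((mazurTateElementK g Ω p n).map ι)
              (((((-1) ^ (n / 2 + 1) * (if ε = 1 then cyclotomicOmegaMinus p n else cyclotomicOmegaPlus p n)).map
                  (Int.castRingHom (PadicAlgCl p)) : (PadicAlgCl p)[X]) : PowerSeries (PadicAlgCl p)) *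
                iwasawaOToPowerSeries (Set.range ι) L)) →
            ∃ d : ℕ, (∀ k : ℕ, ‖PowerSeries.coeff k (iwasawaOToPowerSeries (Set.range ι) L)‖ ≤
                ‖PowerSeries.coeff d (iwasawaOToPowerSeries (Set.range ι) L)‖) ∧
              (∀ k : ℕ, k < d → ‖PowerSeries.coeff k (iwasawaOToPowerSeries (Set.range ι) L)‖ <
                ‖PowerSeries.coeff d (iwasawaOToPowerSeries (Set.range ι) L)‖) ∧
              d + ∑ v ∈ S₀, p ^ (frobeniusExponent p (natGenerator v : ℤ_[p])).valuation *
                layerLambda ((1 - C (embCoeff g ι (natGenerator v)) * X +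
                  (if natGenerator v ∣ M then 0 else C (natGenerator v : PadicAlgCl p)) * X ^ 2).comp
                    (C ((natGenerator v : PadicAlgCl p)⁻¹) * (X + 1))) ≤
                lambdaInvariant p D.X + ∑ v ∈ S₀, delta W p v) :
    Summit.BirchSwinnertonDyer.BirchSwinnertonDyer.Theses.SignedLowerHalves.SmallImageLowerHalfBothSigns := by
  intro W _ _ p _ hp2 hX hCM hap hs ε
  have hT := lamTransport_le_tiered3_of_existsPartnerPSB h12 hKim hPR hmod hD hC hS h5 h3 hV hKan hEX3 W p hp2 hX hCM hap hs
  by_cases hp3 : p = 3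
  · exact forall_kobayashiLowerDivisibility_three_of_lamTransport_le W p hp3 hJ h12 h41 h5 h3 hX hap hs
      (fun ε' κ γ hκ hγ hγ' _ f hf ϖ hϖ Lplus Lminus hPP hfl D _ hXt hμ G m hG ↦
        hT ε' κ γ hκ hγ hγ' f hf ϖ hϖ Lplus Lminus hPP hfl D hXt hμ G m hG) ε
  · have hp5 : 5 ≤ p := by
      have h2 := (Fact.out : p.Prime).two_le
      by_contra h
      interval_cases p
      · exact hp2 rfl
      · exact hp3 rfl
      · exact absurd (Fact.out : Nat.Prime 4) (by decide)
    obtain ⟨ε₀, hε₀⟩ := LargeImageMuFloor.exists_sign_forall_isNewformOf (W := W)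
      (fun ε f ↦ ∃ L₀ : IwasawaAlgebra p, IsSignedPAdicLFunction f p ε L₀ ∧ HasUnitContent L₀)
      (fun f hf ↦ hfloor5 W p hp5 hX hCM hap hs f hf)
    have hfl : ∀ [NeZero (W.conductorNorm ℤ)] (f : CuspForm (Gamma0 (W.conductorNorm ℤ)) 2), IsNewformOf W f →
        ∀ Lplus Lminus : IwasawaAlgebra p, IsPollackPair f p Lplus Lminus →
          HasUnitContent (kobayashiL ε₀ Lplus Lminus) := by
      intro _ f hf Lplus Lminus hPP
      obtain ⟨L₀, hL₀, hu⟩ := hε₀ f hf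
      rwa [IsSignedPAdicLFunction.unique hL₀ (hPP.isSignedPAdicLFunction_kobayashiL ε₀)] at hu
    have hMC : KobayashiMainConjecture W p ε₀ :=
      kobayashiMainConjecture_of_lamTransport_le W p hp2 (thm62_63_73_signedColemanKato_zeta_of_joint hJ) h12 h41 h5 h3
        hX.1.1 hap hs ε₀ (fun f hf Lplus Lminus hPP ↦ hfl f hf Lplus Lminus hPP)
        (fun κ γ hκ hγ hγ' _ f hf ϖ hϖ Lplus Lminus hPP D _ hXt hμ G m hG ↦
          hT ε₀ κ γ hκ hγ hγ' f hf ϖ hϖ Lplus Lminus hPP (hfl f hf Lplus Lminus hPP) D hXt hμ G m hG)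
    exact (SignDefect.X7.exists_kobayashiLowerDivisibility_iff_forall W p h12 h5 h3 hJ hp2 hX hap).mp
      ⟨ε₀, kobayashiLowerDivisibility_of_mainConjecture hMC⟩ ε

end ClassWide

end Summit.BirchSwinnertonDyer.BirchSwinnertonDyer.Theorems.SmallImageRttOneSided

end
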